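import Mathlib.Analysis.InnerProductSpace.Dual
import Literature.Analysis.Calculus.HardyExterior
import Literature.Geometry.Lorentzian.KerrFiniteSpeedOfPropagation
import Literature.Geometry.Lorentzian.KerrHyperboloidalLeaves
import Literature.Geometry.Lorentzian.KerrTimeDerivative
import Literature.Geometry.Lorentzian.KerrWaveDecay
import HarnessLib

/-!
# Hardy's inequality on the far part of the Kerr–Schild leaves for admissible waves:
# `∫_{‖y‖ > R} ψ²/‖y‖² dy ≤ 4 ∫_{‖y‖ > R} ∑_μ (∂_μψ)² dy ≤ 4 · sliceEnergy`

(family `gr`, infrastructure for statement **gr.S24**; namespace `Literature.Geometry.Lorentzian`)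

Dafermos–Rodnianski–Shlapentokh-Rothman (*Decay for solutions of the wave equation on Kerr
exterior spacetimes III*, arXiv:1402.7034 = Ann. of Math. 183 (2016), §4.3) use Hardy
inequalities "to estimate a weighted `L²` norm (spacetime or spacelike) of `ψ` from energy
quantities", deriving them on their hypersurfaces from one-dimensional inequalities "in view of
our comments concerning the volume form"; at large `r` this is the zeroth-order control entering
the large-`r` estimate Prop. 4.6.1 and the cut-off errors of §§9.2, 9.6 in the proof of the
integrated local energy decay (25) of their Theorem 3.2 (the named fact behind
`drsr_wave_integrated_decay_kerr`). In the ingoing Kerr–Schild chart of this tree the leaves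
`{t* = τ}` carry the Euclidean volume `dy` (`det g = −1`) and the energy vocabulary is the
coordinate energy density `∑_μ (∂_μ ψ̃)²` (`coordEnergyDensity`) and its slice integral
`sliceEnergy` (`WeightedNorms.lean`). This file **proves** the corresponding Hardy inequality for
admissible waves (`IsAdmissibleKerrWave`: smooth solutions on the exterior with data compactly
supported in the open leaf `{t* = 0} ∩ {r > r₊}`), from the `ℝⁿ` exterior Hardy inequality
`Literature.Analysis.Calculus.hardy_sq_integral_exterior_le` (`n = 3`, constant `4`):

* `IsAdmissibleKerrWave.hardy_far_slice` — for subextremal `(M, a)`, `τ ≥ 0` and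
  `R > R_af = Kerr.afRadius a r₊` (so that `{‖y‖ > R}` lies in the exterior slice),
  `∫_{‖y‖ > R} ψ̃(τ, y)²/‖y‖² dy ≤ 4 ∫_{‖y‖ > R} ∑_μ (∂_μ ψ̃)²(τ, y) dy`;
* `IsAdmissibleKerrWave.lintegral_far_slice_le_sliceEnergy` — the same in the `ℝ≥0∞`
  vocabulary of the tree: `∫⁻_{‖y‖ > R} (ψ̃²/‖y‖²)(τ, y) ≤ 4 · sliceEnergy (Kerr.exterior M a) ψ τ`.

Ingredients: the slice `y ↦ ψ̃(τ, y)` is smooth on `{‖y‖ > R_af}` (`contDiffAt_extend`,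
`E4.contDiff_ofTimeSpace`) and vanishes for `‖y‖ > ρ + τ` by finite speed of propagation in the
ingoing chart (`kerr_finite_speed_of_propagation_holds`,
`IsAdmissibleKerrWave.exists_eq_zero_of_lt_spatialNorm`); multiplied by a radial cut-off equal to
`1` on `{‖y‖ ≥ R}` it is a `C¹` compactly supported function on `E3` to which the exterior Hardy
inequality applies, and on `{‖y‖ > R}` the squared operator norm of the slice differential is at
most `∑_{i=1}^3 (∂_iψ̃)² ≤ ∑_μ (∂_μψ̃)²`. Everything below is proved; no named facts.

## References

* M. Dafermos, I. Rodnianski, Y. Shlapentokh-Rothman, arXiv:1402.7034 = Ann. of Math. 183 (2016),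
  §4.3; Prop. 4.6.1 (key `DafermosRodnianskiShlapentokhrothman2014`).
* M. Dafermos, I. Rodnianski, arXiv:1010.5132, §4.3 (key `DafermosRodnianski2010KerrSmallA`).
-/

noncomputable section

open Set Filter MeasureTheory Metric TopologicalSpace Module
open scoped Topology ENNReal Manifold ContDiff

namespace Literature.Geometry.Lorentzian

/-! ### Linear algebra on `E3`: the operator norm of a functional and the coordinate sums -/

/-- For a functional `L` on `E3`, `‖L‖² = ∑ᵢ L(eᵢ)²` (Riesz representation and the Euclidean norm).
[folklore] -/
theorem norm_sq_eq_sum_sq_apply_single (L : E3 →L[ℝ] ℝ) :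
    ‖L‖ ^ 2 = ∑ i : Fin 3, (L (EuclideanSpace.single i (1 : ℝ))) ^ 2 := by
  set w : E3 := (InnerProductSpace.toDual ℝ E3).symm L with hw
  have hL : ∀ v, L v = inner ℝ w v := fun v ↦ by
    rw [hw, InnerProductSpace.toDual_symm_apply]
  have hnorm : ‖L‖ = ‖w‖ := by
    rw [hw, LinearIsometryEquiv.norm_map]
  rw [hnorm, EuclideanSpace.norm_sq_eq]
  refine Finset.sum_congr rfl fun i _ ↦ ?_
  rw [hL, EuclideanSpace.inner_single_right]
  simp

/-- The slice embedding sends the spatial unit vectors to the spatial unit vectors of `E4`: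
`(0, eᵢ) = e_{i+1}`. [folklore] -/
theorem E4.ofTimeSpace_zero_single (i : Fin 3) :
    E4.ofTimeSpace 0 (EuclideanSpace.single i (1 : ℝ)) = EuclideanSpace.single i.succ (1 : ℝ) := by
  ext μ
  refine Fin.cases ?_ (fun j ↦ ?_) μ
  · simp [(Fin.succ_ne_zero i).symm]
  · simp

/-- **The slice differential is dominated by the coordinate energy density**: for `Φ : E4 → ℝ`
differentiable at `x = (τ, y)`, `‖D(Φ ∘ (τ, ·))(y)‖² ≤ ∑_μ (∂_μ Φ)(x)²` (the left side is
`∑_{i=1}^3 (∂_iΦ)²`). [folklore] -/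
theorem norm_fderiv_slice_sq_le (Φ : E4 → ℝ) (τ : ℝ) (y : E3)
    (hΦ : DifferentiableAt ℝ Φ (E4.ofTimeSpace τ y)) :
    ‖fderiv ℝ (fun z ↦ Φ (E4.ofTimeSpace τ z)) y‖ ^ 2 ≤
      ∑ μ : Fin 4, (fderiv ℝ Φ (E4.ofTimeSpace τ y) (EuclideanSpace.single μ (1 : ℝ))) ^ 2 := by
  have hcomp : fderiv ℝ (fun z ↦ Φ (E4.ofTimeSpace τ z)) y =
      (fderiv ℝ Φ (E4.ofTimeSpace τ y)).comp E4.spaceEmbed :=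
    (hΦ.hasFDerivAt.comp y (E4.hasFDerivAt_ofTimeSpace τ y)).fderiv
  rw [hcomp, norm_sq_eq_sum_sq_apply_single]
  simp only [ContinuousLinearMap.coe_comp, Function.comp_apply, E4.spaceEmbed_apply,
    E4.ofTimeSpace_zero_single]
  rw [Fin.sum_univ_succ (fun μ : Fin 4 ↦
    (fderiv ℝ Φ (E4.ofTimeSpace τ y) (EuclideanSpace.single μ (1 : ℝ))) ^ 2)]
  linarith [sq_nonneg (fderiv ℝ Φ (E4.ofTimeSpace τ y) (EuclideanSpace.single 0 (1 : ℝ)))]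

/-! ### Integrability on far shells -/

/-- A function on `E3` which is continuous at every point of `{‖y‖ > R₀}` and vanishes on
`{‖y‖ > B}` is integrable on `{‖y‖ > R}` for every `R > R₀` (it is continuous on the compact
shell `{R ≤ ‖y‖ ≤ |B| + |R|}` and zero beyond it). [folklore] -/
theorem integrableOn_far_of_continuousAt_of_eq_zero {φ : E3 → ℝ} {R₀ R B : ℝ} (hR : R₀ < R)
    (hc : ∀ y : E3, R₀ < ‖y‖ → ContinuousAt φ y) (h0 : ∀ y : E3, B < ‖y‖ → φ y = 0) :
    IntegrableOn φ {y : E3 | R < ‖y‖} := by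
  have hSm : MeasurableSet {y : E3 | R < ‖y‖} :=
    (isOpen_lt continuous_const continuous_norm).measurableSet
  set K : Set E3 := {y | R ≤ ‖y‖} ∩ closedBall 0 (|B| + |R|) with hK
  have hKc : IsCompact K :=
    (isCompact_closedBall _ _).inter_left (isClosed_le continuous_const continuous_norm)
  have hφK : ContinuousOn φ K := fun y hy ↦ by
    refine (hc y ?_).continuousWithinAt
    have : R ≤ ‖y‖ := hy.1
    linarith
  have hIK : IntegrableOn φ K := hφK.integrableOn_compact hKc
  refine (hIK.mono_set (inter_subset_right : {y : E3 | R < ‖y‖} ∩ K ⊆ K)).of_forall_sdiff_eq_zero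
    hSm ?_
  intro y hy
  have hyS : R < ‖y‖ := hy.1
  have hyK : y ∉ K := fun h ↦ hy.2 ⟨hy.1, h⟩
  have hfar : |B| + |R| < ‖y‖ := by
    by_contra h
    exact hyK ⟨le_of_lt hyS, mem_closedBall_zero_iff.2 (not_lt.1 h)⟩
  exact h0 y (lt_of_le_of_lt (le_abs_self B) (by linarith [abs_nonneg R]))

/-! ### The far part of the slice of an admissible wave -/

/-- **Support of the far slices** (finite speed of propagation in the ingoing chart,
`kerr_finite_speed_of_propagation_holds`): for an admissible wave `ψ` on subextremal Kerr and
`τ ≥ 0` there is `ρ ≥ 0` such that `ψ̃(τ, y) = 0` and `Dψ̃(τ, y) = 0` whenever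
`‖y‖ > afRadius a r₊` and `‖y‖ > ρ + τ`. DRSR, arXiv:1402.7034, §2.2.5, §4.1. [folklore] -/
theorem IsAdmissibleKerrWave.far_slice_eq_zero [Kerr.Facts] [Kerr.SliceFacts] {M a : ℝ}
    (hMa : Kerr.IsSubextremal M a) {ψ : Kerr.exterior M a → ℝ} (hψ : IsAdmissibleKerrWave M a ψ)
    {τ : ℝ} (hτ : 0 ≤ τ) :
    ∃ ρ : ℝ, 0 ≤ ρ ∧ ∀ y : E3, Kerr.afRadius a (Kerr.rPlus M a) < ‖y‖ → ρ + τ < ‖y‖ →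
      Function.extend Subtype.val ψ 0 (E4.ofTimeSpace τ y) = 0 ∧
        fderiv ℝ (Function.extend Subtype.val ψ 0) (E4.ofTimeSpace τ y) = 0 := by
  obtain ⟨ρ, hρ0, hρ⟩ :=
    hψ.exists_eq_zero_of_lt_spatialNorm kerr_finite_speed_of_propagation_holds hMa
  refine ⟨ρ, hρ0, fun y hy1 hy2 ↦ ?_⟩
  have hx : E4.ofTimeSpace τ y ∈ Kerr.exterior M a :=
    Kerr.ofTimeSpace_mem_exterior_iff.mpr (Kerr.mem_slice_of_lt_norm hy1)
  have h := hρ ⟨_, hx⟩ (by simp [hτ]) (by simpa using hy2)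
  refine ⟨?_, Kerr.fderiv_extend_eq_zero (by simp) hψ.1 ⟨_, hx⟩ h.2⟩
  have h1 := h.1
  rw [extend_rep ψ ⟨_, hx⟩] at h1
  exact h1

/-- The slice `y ↦ ψ̃(τ, y)` of an admissible wave is smooth at every `y` with
`‖y‖ > afRadius a r₊` (such `(τ, y)` are exterior points). [folklore] -/
theorem IsAdmissibleKerrWave.contDiffAt_slice [Kerr.Facts] [Kerr.SliceFacts] {M a : ℝ}
    {ψ : Kerr.exterior M a → ℝ} (hψ : IsAdmissibleKerrWave M a ψ) (τ : ℝ) {y : E3}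
    (hy : Kerr.afRadius a (Kerr.rPlus M a) < ‖y‖) :
    ContDiffAt ℝ ∞ (fun z : E3 ↦ Function.extend Subtype.val ψ 0 (E4.ofTimeSpace τ z)) y := by
  have hx : E4.ofTimeSpace τ y ∈ Kerr.exterior M a :=
    Kerr.ofTimeSpace_mem_exterior_iff.mpr (Kerr.mem_slice_of_lt_norm hy)
  have h1 : ContDiffAt ℝ ∞ (Function.extend Subtype.val ψ 0) (E4.ofTimeSpace τ y) :=
    contDiffAt_extend hψ.1 ⟨_, hx⟩
  exact h1.comp y (E4.contDiff_ofTimeSpace τ).contDiffAt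

/-- The coordinate energy density along the slice, `y ↦ ∑_μ (∂_μψ̃)²(τ, y)`, is continuous at
every `y` with `‖y‖ > afRadius a r₊`. [folklore] -/
theorem IsAdmissibleKerrWave.continuousAt_coordEnergyDensity_slice [Kerr.Facts] [Kerr.SliceFacts]
    {M a : ℝ} {ψ : Kerr.exterior M a → ℝ} (hψ : IsAdmissibleKerrWave M a ψ) (τ : ℝ) {y : E3}
    (hy : Kerr.afRadius a (Kerr.rPlus M a) < ‖y‖) :
    ContinuousAt (fun z : E3 ↦ coordEnergyDensity (Kerr.exterior M a) ψ (E4.ofTimeSpace τ z))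
      y := by
  have hx : E4.ofTimeSpace τ y ∈ Kerr.exterior M a :=
    Kerr.ofTimeSpace_mem_exterior_iff.mpr (Kerr.mem_slice_of_lt_norm hy)
  have h1 : ContDiffAt ℝ ∞ (Function.extend Subtype.val ψ 0) (E4.ofTimeSpace τ y) :=
    contDiffAt_extend hψ.1 ⟨_, hx⟩
  have h3 : ∀ μ : Fin 4, ContinuousAt (fun z : E3 ↦ (fderiv ℝ (Function.extend Subtype.val ψ 0)
      (E4.ofTimeSpace τ z) (EuclideanSpace.single μ (1 : ℝ))) ^ 2) y := fun μ ↦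
    (((contDiffAt_fderiv_apply_const_infty h1 (EuclideanSpace.single μ (1 : ℝ))).comp y
      (E4.contDiff_ofTimeSpace τ).contDiffAt).continuousAt).pow 2
  unfold coordEnergyDensity
  exact tendsto_finsetSum _ fun μ _ ↦ h3 μ

/-- The coordinate energy density along the slice of an admissible wave is integrable on
`{‖y‖ > R}`, `R > afRadius a r₊`, for `τ ≥ 0` (continuous there and compactly supported by
finite speed of propagation). [folklore] -/
theorem IsAdmissibleKerrWave.integrableOn_coordEnergyDensity_far [Kerr.Facts] [Kerr.SliceFacts]
    {M a : ℝ} (hMa : Kerr.IsSubextremal M a) {ψ : Kerr.exterior M a → ℝ}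
    (hψ : IsAdmissibleKerrWave M a ψ) {τ : ℝ} (hτ : 0 ≤ τ) {R : ℝ}
    (hR : Kerr.afRadius a (Kerr.rPlus M a) < R) :
    IntegrableOn (fun y : E3 ↦ coordEnergyDensity (Kerr.exterior M a) ψ (E4.ofTimeSpace τ y))
      {y : E3 | R < ‖y‖} := by
  obtain ⟨ρ, -, hρ⟩ := hψ.far_slice_eq_zero hMa hτ
  refine integrableOn_far_of_continuousAt_of_eq_zero hR
    (fun y hy ↦ hψ.continuousAt_coordEnergyDensity_slice τ hy)
    (B := max (ρ + τ) (Kerr.afRadius a (Kerr.rPlus M a))) fun y hy ↦ ?_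
  rw [max_lt_iff] at hy
  unfold coordEnergyDensity
  refine Finset.sum_eq_zero fun μ _ ↦ ?_
  simp [(hρ y hy.2 hy.1).2]

/-- The weighted square `ψ̃(τ, y)²/‖y‖²` of the slice of an admissible wave is integrable on
`{‖y‖ > R}`, `R > afRadius a r₊`, for `τ ≥ 0`. [folklore] -/
theorem IsAdmissibleKerrWave.integrableOn_sq_div_norm_sq_far [Kerr.Facts] [Kerr.SliceFacts]
    {M a : ℝ} (hMa : Kerr.IsSubextremal M a) {ψ : Kerr.exterior M a → ℝ}
    (hψ : IsAdmissibleKerrWave M a ψ) {τ : ℝ} (hτ : 0 ≤ τ) {R : ℝ}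
    (hR : Kerr.afRadius a (Kerr.rPlus M a) < R) :
    IntegrableOn (fun y : E3 ↦
      (Function.extend Subtype.val ψ 0 (E4.ofTimeSpace τ y)) ^ 2 / ‖y‖ ^ 2) {y : E3 | R < ‖y‖} := by
  obtain ⟨ρ, -, hρ⟩ := hψ.far_slice_eq_zero hMa hτ
  have hRa : 0 < Kerr.afRadius a (Kerr.rPlus M a) := by
    unfold Kerr.afRadius
    positivity
  refine integrableOn_far_of_continuousAt_of_eq_zero hR (fun y hy ↦ ?_)
    (B := max (ρ + τ) (Kerr.afRadius a (Kerr.rPlus M a))) fun y hy ↦ ?_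
  · have hy0 : ‖y‖ ≠ 0 := (hRa.trans hy).ne'
    exact ((hψ.contDiffAt_slice τ hy).continuousAt.pow 2).div (continuous_norm.continuousAt.pow 2)
      (pow_ne_zero 2 hy0)
  · rw [max_lt_iff] at hy
    simp [(hρ y hy.2 hy.1).1]

/-! ### Hardy's inequality on the far part of the leaves -/

/-- **Hardy's inequality on the far part of the Kerr–Schild leaf `{t* = τ}` for admissible
waves** (Dafermos–Rodnianski–Shlapentokh-Rothman, arXiv:1402.7034, §4.3: Hardy inequalities on the
slices derived from the one-dimensional ones; here from the `ℝ³` exterior Hardy inequality with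
constant `4`). For subextremal `(M, a)`, an admissible wave `ψ`, `τ ≥ 0` and `R > afRadius a r₊`,
`∫_{‖y‖ > R} ψ̃(τ, y)²/‖y‖² dy ≤ 4 ∫_{‖y‖ > R} ∑_μ (∂_μψ̃)²(τ, y) dy`, where
`ψ̃ = Function.extend Subtype.val ψ 0`. [cite: DafermosRodnianskiShlapentokhrothman2014, §4.3] -/
theorem IsAdmissibleKerrWave.hardy_far_slice [Kerr.Facts] [Kerr.SliceFacts] {M a : ℝ}
    (hMa : Kerr.IsSubextremal M a) {ψ : Kerr.exterior M a → ℝ} (hψ : IsAdmissibleKerrWave M a ψ)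
    {τ : ℝ} (hτ : 0 ≤ τ) {R : ℝ} (hR : Kerr.afRadius a (Kerr.rPlus M a) < R) :
    ∫ y in {y : E3 | R < ‖y‖},
        (Function.extend Subtype.val ψ 0 (E4.ofTimeSpace τ y)) ^ 2 / ‖y‖ ^ 2 ≤
      4 * ∫ y in {y : E3 | R < ‖y‖},
        coordEnergyDensity (Kerr.exterior M a) ψ (E4.ofTimeSpace τ y) := by
  -- notation: `Φ = ψ̃`, `f` its slice at time `τ`, `Ra` the radius of the asymptotic end
  obtain ⟨Φ, hΦ⟩ : ∃ Φ : E4 → ℝ, Φ = Function.extend Subtype.val ψ 0 := ⟨_, rfl⟩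
  obtain ⟨f, hf⟩ : ∃ f : E3 → ℝ, ∀ y, f y = Φ (E4.ofTimeSpace τ y) := ⟨_, fun _ ↦ rfl⟩
  have hff : f = fun y ↦ Φ (E4.ofTimeSpace τ y) := funext hf
  obtain ⟨Ra, hRa⟩ : ∃ Ra : ℝ, Ra = Kerr.afRadius a (Kerr.rPlus M a) := ⟨_, rfl⟩
  have hRa' : ∀ y : E3, Ra < ‖y‖ → Kerr.afRadius a (Kerr.rPlus M a) < ‖y‖ := fun y hy ↦ by
    rwa [hRa] at hy
  have hRaR : Ra < R := by rwa [← hRa] at hR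
  have hSm : MeasurableSet {y : E3 | R < ‖y‖} :=
    (isOpen_lt continuous_const continuous_norm).measurableSet
  have hRa0 : 0 < Ra := by
    rw [hRa]
    unfold Kerr.afRadius
    positivity
  have hRpos : 0 < R := hRa0.trans hRaR
  -- smoothness of the slice beyond `Ra`, vanishing beyond `ρ + τ`
  have hfC : ∀ y : E3, Ra < ‖y‖ → ContDiffAt ℝ ∞ f y := fun y hy ↦ by
    rw [hff, hΦ]
    exact hψ.contDiffAt_slice τ (hRa' y hy)
  obtain ⟨ρ, -, hρ⟩ := hψ.far_slice_eq_zero hMa hτ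
  have hf0 : ∀ y : E3, Ra < ‖y‖ → ρ + τ < ‖y‖ → f y = 0 := fun y hy1 hy2 ↦ by
    rw [hf y, hΦ]
    exact (hρ y (hRa' y hy1) hy2).1
  -- the radial cut-off `χ = 1` on `{‖y‖ ≥ R}`, `χ = 0` on `{‖y‖ ≤ R₁}`, `Ra < R₁ < R`
  obtain ⟨R₁, hR₁⟩ : ∃ R₁ : ℝ, R₁ = (Ra + R) / 2 := ⟨_, rfl⟩
  have hR₁a : Ra < R₁ := by
    rw [hR₁]
    linarith
  have hR₁R : R₁ < R := by
    rw [hR₁]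
    linarith
  obtain ⟨χ, hχ⟩ : ∃ χ : E3 → ℝ, χ = fun y ↦
      Real.smoothTransition ((‖y‖ ^ 2 - R₁ ^ 2) / (R ^ 2 - R₁ ^ 2)) := ⟨_, rfl⟩
  have hχy : ∀ y : E3, χ y = Real.smoothTransition ((‖y‖ ^ 2 - R₁ ^ 2) / (R ^ 2 - R₁ ^ 2)) :=
    fun y ↦ by rw [hχ]
  have hden : 0 < R ^ 2 - R₁ ^ 2 := by nlinarith
  have hχC : ContDiff ℝ ∞ χ := by
    rw [hχ]
    exact Real.smoothTransition.contDiff.comp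
      (((contDiff_norm_sq ℝ).sub contDiff_const).div_const _)
  have hχ0 : ∀ y : E3, ‖y‖ ≤ R₁ → χ y = 0 := by
    intro y hy
    rw [hχy]
    refine Real.smoothTransition.zero_of_nonpos (div_nonpos_of_nonpos_of_nonneg ?_ hden.le)
    nlinarith [norm_nonneg y]
  have hχ1 : ∀ y : E3, R ≤ ‖y‖ → χ y = 1 := by
    intro y hy
    rw [hχy]
    refine Real.smoothTransition.one_of_one_le ((one_le_div hden).2 ?_)
    nlinarith [norm_nonneg y]
  -- the test function `u = χ f ∈ C¹_c(E3)`
  obtain ⟨u, hu⟩ : ∃ u : E3 → ℝ, ∀ y, u y = χ y * f y := ⟨_, fun _ ↦ rfl⟩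
  have huf : u = fun y ↦ χ y * f y := funext hu
  have huC : ContDiff ℝ 1 u := by
    rw [contDiff_iff_contDiffAt]
    intro y
    by_cases hy : ‖y‖ < R₁
    · -- `u = 0` near `y`
      have : u =ᶠ[𝓝 y] fun _ ↦ 0 := by
        filter_upwards [(isOpen_lt continuous_norm continuous_const).mem_nhds hy] with z hz
        rw [hu z, hχ0 z (le_of_lt hz), zero_mul]
      exact contDiffAt_const.congr_of_eventuallyEq this
    · have hy' : Ra < ‖y‖ := hR₁a.trans_le (not_lt.1 hy)
      rw [huf]
      exact (hχC.contDiffAt.of_le (mod_cast le_top)).mul ((hfC y hy').of_le (mod_cast le_top))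
  have huc : HasCompactSupport u := by
    refine HasCompactSupport.intro (isCompact_closedBall (0 : E3) (max (ρ + τ) R₁)) ?_
    intro y hy
    rw [mem_closedBall_zero_iff, not_le, max_lt_iff] at hy
    rw [hu y, hf0 y (hR₁a.trans hy.2) hy.1, mul_zero]
  -- the `ℝ³` exterior Hardy inequality for `u`
  have hn : 3 ≤ finrank ℝ E3 := by simp
  have hH := Literature.Analysis.Calculus.hardy_sq_integral_exterior_le huC huc hRpos hn
  have hconst : (2 / ((finrank ℝ E3 : ℝ) - 2)) ^ 2 = 4 := by
    rw [finrank_euclideanSpace_fin]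
    norm_num
  rw [hconst] at hH
  -- on `{‖y‖ > R}`: `u = f` near every point, so `Du = Df`, and `‖Df‖² ≤ ∑_μ (∂_μΦ)²`
  have huS : ∀ y ∈ {y : E3 | R < ‖y‖}, u =ᶠ[𝓝 y] f := by
    intro y hy
    filter_upwards [(isOpen_lt continuous_const continuous_norm).mem_nhds hy] with z hz
    rw [hu z, hχ1 z (le_of_lt hz), one_mul]
  have hLHS : ∫ y in {y : E3 | R < ‖y‖}, u y ^ 2 / ‖y‖ ^ 2 =
      ∫ y in {y : E3 | R < ‖y‖},
        (Function.extend Subtype.val ψ 0 (E4.ofTimeSpace τ y)) ^ 2 / ‖y‖ ^ 2 := by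
    refine setIntegral_congr_fun hSm fun y hy ↦ ?_
    rw [(huS y hy).eq_of_nhds, hf y, hΦ]
  have hpt : ∀ y ∈ {y : E3 | R < ‖y‖}, ‖fderiv ℝ u y‖ ^ 2 ≤
      coordEnergyDensity (Kerr.exterior M a) ψ (E4.ofTimeSpace τ y) := by
    intro y hy
    have hyR : R < ‖y‖ := hy
    have hya : Kerr.afRadius a (Kerr.rPlus M a) < ‖y‖ := hRa' y (hRaR.trans hyR)
    have hx : E4.ofTimeSpace τ y ∈ Kerr.exterior M a :=
      Kerr.ofTimeSpace_mem_exterior_iff.mpr (Kerr.mem_slice_of_lt_norm hya)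
    have hd : DifferentiableAt ℝ Φ (E4.ofTimeSpace τ y) := by
      have h := contDiffAt_extend hψ.1 ⟨_, hx⟩
      rw [← hΦ] at h
      exact h.differentiableAt (by simp)
    rw [(huS y hy).fderiv_eq, hff]
    unfold coordEnergyDensity
    rw [← hΦ]
    exact norm_fderiv_slice_sq_le Φ τ y hd
  have hI1 : IntegrableOn (fun y ↦ ‖fderiv ℝ u y‖ ^ 2) {y : E3 | R < ‖y‖} := by
    refine (Continuous.integrable_of_hasCompactSupport ?_ ?_).integrableOn
    · exact (continuous_norm.comp (huC.continuous_fderiv one_ne_zero)).pow 2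
    · refine HasCompactSupport.intro huc (fun y hy ↦ ?_)
      simp [fderiv_of_notMem_tsupport ℝ hy]
  have hI2 := hψ.integrableOn_coordEnergyDensity_far hMa hτ hR
  have hRHS := setIntegral_mono_on hI1 hI2 hSm hpt
  -- assemble
  rw [← hLHS]
  exact hH.trans (mul_le_mul_of_nonneg_left hRHS (by norm_num))

/-- **Hardy's inequality on the far part of the leaves, in the `ℝ≥0∞` energy vocabulary**: for
subextremal `(M, a)`, an admissible wave `ψ`, `τ ≥ 0` and `R > afRadius a r₊`,
`∫⁻_{‖y‖ > R} (ψ̃(τ, y)²/‖y‖²) ≤ 4 · sliceEnergy (Kerr.exterior M a) ψ τ`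
(Dafermos–Rodnianski–Shlapentokh-Rothman, arXiv:1402.7034, §4.3: "to estimate a weighted `L²`
norm […] of `ψ` from energy quantities"). [cite: DafermosRodnianskiShlapentokhrothman2014, §4.3] -/
theorem IsAdmissibleKerrWave.lintegral_far_slice_le_sliceEnergy [Kerr.Facts] [Kerr.SliceFacts]
    {M a : ℝ} (hMa : Kerr.IsSubextremal M a) {ψ : Kerr.exterior M a → ℝ}
    (hψ : IsAdmissibleKerrWave M a ψ) {τ : ℝ} (hτ : 0 ≤ τ) {R : ℝ}
    (hR : Kerr.afRadius a (Kerr.rPlus M a) < R) :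
    ∫⁻ y in {y : E3 | R < ‖y‖},
        ENNReal.ofReal ((Function.extend Subtype.val ψ 0 (E4.ofTimeSpace τ y)) ^ 2 / ‖y‖ ^ 2) ≤
      4 * sliceEnergy (Kerr.exterior M a) ψ τ := by
  have hSm : MeasurableSet {y : E3 | R < ‖y‖} :=
    (isOpen_lt continuous_const continuous_norm).measurableSet
  have hmain := hψ.hardy_far_slice hMa hτ hR
  have hint := hψ.integrableOn_sq_div_norm_sq_far hMa hτ hR
  have hgi := hψ.integrableOn_coordEnergyDensity_far hMa hτ hR
  have hmem : ∀ y ∈ {y : E3 | R < ‖y‖}, E4.ofTimeSpace τ y ∈ Kerr.exterior M a := fun y hy ↦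
    Kerr.ofTimeSpace_mem_exterior_iff.mpr (Kerr.mem_slice_of_lt_norm (hR.trans hy))
  have hg0 : ∀ y : E3, 0 ≤ coordEnergyDensity (Kerr.exterior M a) ψ (E4.ofTimeSpace τ y) :=
    fun y ↦ coordEnergyDensity_nonneg _ _ _
  have hh0 : ∀ y : E3,
      0 ≤ (Function.extend Subtype.val ψ 0 (E4.ofTimeSpace τ y)) ^ 2 / ‖y‖ ^ 2 :=
    fun y ↦ div_nonneg (sq_nonneg _) (sq_nonneg _)
  -- the right side: `∫⁻_{‖y‖ > R} ∑_μ (∂_μψ̃)² ≤ sliceEnergy`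
  have hRHS : ∫⁻ y in {y : E3 | R < ‖y‖},
      ENNReal.ofReal (coordEnergyDensity (Kerr.exterior M a) ψ (E4.ofTimeSpace τ y)) ≤
      sliceEnergy (Kerr.exterior M a) ψ τ := by
    calc ∫⁻ y in {y : E3 | R < ‖y‖},
          ENNReal.ofReal (coordEnergyDensity (Kerr.exterior M a) ψ (E4.ofTimeSpace τ y))
        = ∫⁻ y in {y : E3 | R < ‖y‖}, {y | E4.ofTimeSpace τ y ∈ Kerr.exterior M a}.indicator
            (fun y ↦ ENNReal.ofReal
              (coordEnergyDensity (Kerr.exterior M a) ψ (E4.ofTimeSpace τ y))) y := by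
          refine setLIntegral_congr_fun hSm fun y hy ↦ ?_
          rw [indicator_of_mem (show y ∈ {y | E4.ofTimeSpace τ y ∈ Kerr.exterior M a} from
            hmem y hy)]
      _ ≤ sliceEnergy (Kerr.exterior M a) ψ τ := setLIntegral_le_lintegral _ _
  calc ∫⁻ y in {y : E3 | R < ‖y‖},
        ENNReal.ofReal ((Function.extend Subtype.val ψ 0 (E4.ofTimeSpace τ y)) ^ 2 / ‖y‖ ^ 2)
      = ENNReal.ofReal (∫ y in {y : E3 | R < ‖y‖},
          (Function.extend Subtype.val ψ 0 (E4.ofTimeSpace τ y)) ^ 2 / ‖y‖ ^ 2) :=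
        (ofReal_integral_eq_lintegral_ofReal hint (ae_of_all _ hh0)).symm
    _ ≤ ENNReal.ofReal (4 * ∫ y in {y : E3 | R < ‖y‖},
          coordEnergyDensity (Kerr.exterior M a) ψ (E4.ofTimeSpace τ y)) :=
        ENNReal.ofReal_le_ofReal hmain
    _ = 4 * ENNReal.ofReal (∫ y in {y : E3 | R < ‖y‖},
          coordEnergyDensity (Kerr.exterior M a) ψ (E4.ofTimeSpace τ y)) := by
        rw [ENNReal.ofReal_mul (by norm_num : (0 : ℝ) ≤ 4), ENNReal.ofReal_ofNat]
    _ = 4 * ∫⁻ y in {y : E3 | R < ‖y‖},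
          ENNReal.ofReal (coordEnergyDensity (Kerr.exterior M a) ψ (E4.ofTimeSpace τ y)) := by
        rw [ofReal_integral_eq_lintegral_ofReal hgi (ae_of_all _ hg0)]
    _ ≤ 4 * sliceEnergy (Kerr.exterior M a) ψ τ := by gcongr

end Literature.Geometry.Lorentzian

end
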